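import Literature.NumberTheory.EllipticCurves.ZpExtensionGaloisTwistSelmerStructure
import HarnessLib

/-!
# The Poitou–Tate lifting with prescribed local images at `p` and `∞` for `E[p^J](χ_u)`
# (Greenberg's `γ'` at finite level; proofs file of `ZpExtensionGaloisTwistSelmerStructure`)

Topic `NumberTheory/EllipticCurves`; namespace `WeierstrassCurve`. THEOREMS ONLY (no definition, no named fact,
no instance; D-0026) — the sibling proofs file of `ZpExtensionGaloisTwistSelmerStructure.lean` (the Selmer
structures `𝓕 = W.twistedKummerSelmerStructure …`, `𝓖 = W.twistedRelaxedSelmerStructure …` and the places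
`S = twistedDescentPlaces p S₀`).

Greenberg (LNM 1716, §4 p. 124): «the map `γ' : H¹(F_Σ/F, M) → 𝒫^{Σ'}(M, F)` is surjective» (for `M = A_s` and the
non-primitive structure), obtained on p. 123 from Poitou–Tate duality («`coker(γ') ≅ (G^* ∩ U'^*)^∧` …
`S'_{T^*}(F)` is trivial and hence so is `coker(γ')`»). At FINITE level `M_J = E[p^J](χ_u)` and for ONE target
this is the element form of Howard's Thm. 2.1.11 (the tree's predicate `LocalInvariants.SelmerComplement`, a
conjunct of the named fact `poitouTate_selmerStructure_duality(_real)`):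

* **`exists_twistedLift_of_orthogonal`** — if `inv` has `SelmerComplement`, `p ∉ v` on `S₀`, `M_J` is unramified
  with `p^J ∉ v` outside `S`, and the target family `t = (t_v)_v` satisfies `∑_{v ∈ S} ⟨t_v, loc_v y⟩_v = 0` for
  every `y ∈ H¹_{𝓕^*}(K, M_J^D)`, then some `x ∈ H¹(Γ_K, E[p^J](χ_u))`, unramified outside `S₀ ∪ {v ∣ p}`, has
  `twistedTorsionToLocalH1 (loc_v x) = twistedTorsionToLocalH1 (t_v)` at every `v ∋ p` and every infinite `w`;
* **`exists_twistedLift_of_orthogonal_two`** — the same with `t` supported at `p` and `∞` and the orthogonality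
  split into the local terms at `p` and at `∞`.

Cell `bsd-2adic` design memo HOME/t42/DESIGN-T42-ADDENDUM-16.md §A16.8, brick (β3). Not here: the orthogonality
(Greenberg's «`S'_{T^*}(F) = 0`»), the local descent producing `t`.

References: R. Greenberg, LNM 1716 (1999), §4 pp. 122–124 [GreenbergLNM1716]; B. Howard, Compositio Math. 140
(2004), Thm. 2.1.11 [Howard2004HeegnerKolyvagin]; J. S. Milne, *Arithmetic Duality Theorems* (2006), I Thm. 4.10
[MilneADT2006]; J. H. Silverman, *AEC* (2009), Cor. III.6.4 [SilvermanAEC2009].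
-/

noncomputable section

open scoped Classical

open NumberField IsDedekindDomain Field
open Literature.NumberTheory.EllipticCurves Literature.NumberTheory.GaloisRepresentations
  Literature.NumberTheory.GaloisCohomology
open Literature.NumberTheory.GaloisRepresentations.DiscreteGaloisModule (localTatePairingZMod
  unramifiedSubgroup SelmerStructure)

universe u

namespace WeierstrassCurve

variable {K : Type u} [Field K] [NumberField K] (W : WeierstrassCurve K) (p : ℕ) [Fact p.Prime]
  (S₀ : Finset (HeightOneSpectrum (𝓞 K))) (κ : ZpExtension K p) (J : ℕ) (u : ℤ) (hu : (p : ℤ) ∣ u - 1)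

/-! ## The Poitou–Tate lifting with prescribed images at `p` and `∞` (Greenberg's `γ'`, finite level) -/

/-! `E[p^J]` finite is taken as an instance binder (true for an elliptic curve: Silverman *AEC* III.6.4, tree
`finite_geomTorsion_of_neZero`; no instance is declared here). -/
variable [Finite (W.geomTorsion ((p ^ J : ℕ) : ℤ))]

/-- **The finite-level `γ'`-lifting (Greenberg p. 124 «the map `γ'` … is surjective», through Howard's
Thm. 2.1.11).** Let `inv` be a family of local invariant maps at level `p^J` with `SelmerComplement`, let
`p ∉ v` for `v ∈ S₀`, and let `E[p^J](χ_u)` be unramified with `p^J ∉ v` outside `S` (`hS`). If a target family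
`t = (t_v)_v`, `t_v ∈ H¹(K_v, E[p^J](χ_u))`, is orthogonal to the dual Selmer group — `∑_{v ∈ S} ⟨t_v, loc_v y⟩_v = 0`
for every `y ∈ H¹_{𝓕^*}(K, E[p^J](χ_u)^D)` — then there is a global class `x ∈ H¹(Γ_K, E[p^J](χ_u))`,
unramified at every finite `v ∉ S₀` prime to `p`, with `twistedTorsionToLocalH1 (loc_v x) = twistedTorsionToLocalH1 t_v`
at every place `v ∋ p` and at every infinite place: the element form of `x ∈ H¹_𝓖(K, M_J)`,
`loc_v x − t_v ∈ 𝓕_v` (`v ∈ S`). [cite: GreenbergLNM1716, §4 pp. 122–124]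
[cite: Howard2004HeegnerKolyvagin, Thm. 2.1.11 (arXiv:1202.6340 p. 6)] -/
theorem exists_twistedLift_of_orthogonal {inv : LocalInvariants K (p ^ J)} (hSC : inv.SelmerComplement)
    (hS₀ : ∀ v ∈ S₀, ((p : ℕ) : 𝓞 K) ∉ v.asIdeal)
    (hS : ∀ v : HeightOneSpectrum (𝓞 K), (Sum.inr v : Place K) ∉ twistedDescentPlaces (K := K) p S₀ →
      ((p ^ J : ℕ) : 𝓞 K) ∉ v.asIdeal ∧ GaloisRep.IsUnramifiedAt v (W.twistedTorsionGaloisModule p κ J u hu))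
    (t : Π v : Place K, galoisCohomology ((W.twistedTorsionGaloisModule p κ J u hu).toLocal v) 1)
    (horth : ∀ y ∈ (inv.dualSelmerStructure (W.twistedTorsionGaloisModule p κ J u hu)
        (W.twistedKummerSelmerStructure p S₀ κ J u hu)).selmerGroup,
      ∑ v ∈ twistedDescentPlaces (K := K) p S₀,
        localTatePairingZMod (W.twistedTorsionGaloisModule p κ J u hu) (p ^ J) v (inv v) (t v)
          (galoisCohomology.localization ((W.twistedTorsionGaloisModule p κ J u hu).tateDual (p ^ J))
            v 1 y) = 0) :
    ∃ x : galoisCohomology (W.twistedTorsionGaloisModule p κ J u hu) 1,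
      (∀ v : HeightOneSpectrum (𝓞 K), v ∉ S₀ → ((p : ℕ) : 𝓞 K) ∉ v.asIdeal →
        galoisCohomology.res (W.twistedTorsionGaloisModule p κ J u hu) (v.adicCompletion K) 1 x ∈
          unramifiedSubgroup
            ((W.twistedTorsionGaloisModule p κ J u hu).restrictField (v.adicCompletion K)) 1) ∧
      (∀ v : HeightOneSpectrum (𝓞 K), ((p : ℕ) : 𝓞 K) ∈ v.asIdeal →
        W.twistedTorsionToLocalH1 p κ J u hu (v.adicCompletion K)
            (galoisCohomology.res (W.twistedTorsionGaloisModule p κ J u hu) (v.adicCompletion K) 1 x) =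
          W.twistedTorsionToLocalH1 p κ J u hu (v.adicCompletion K) (t (Sum.inr v))) ∧
      (∀ w : InfinitePlace K,
        W.twistedTorsionToLocalH1 p κ J u hu w.Completion
            (galoisCohomology.res (W.twistedTorsionGaloisModule p κ J u hu) w.Completion 1 x) =
          W.twistedTorsionToLocalH1 p κ J u hu w.Completion (t (Sum.inl w))) := by
  have hM : ∀ m : geomTorsion W ((p ^ J : ℕ) : ℤ), (p ^ J) • m = 0 := W.pow_nsmul_geomTorsion_pow p J
  obtain ⟨x, hx, hxt⟩ := (hSC (W.twistedTorsionGaloisModule p κ J u hu) hM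
    (twistedDescentPlaces (K := K) p S₀)
    hS
    (W.twistedKummerSelmerStructure p S₀ κ J u hu) (W.twistedRelaxedSelmerStructure p S₀ κ J u hu)
    (W.twistedKummerSelmerStructure_le_relaxed p S₀ κ J u hu)
    (W.isUnramifiedOutside_twistedKummerSelmerStructure p S₀ κ J u hu)
    (W.isUnramifiedOutside_twistedRelaxedSelmerStructure p S₀ κ J u hu)).1 t
    (fun v hv ↦ by
      rw [W.twistedRelaxedSelmerStructure_eq_top_of_mem p S₀ κ J u hu hv]
      exact AddSubgroup.mem_top _)
    horth
  refine ⟨x, fun v hv hpv ↦ W.res_mem_unramifiedSubgroup_of_mem_selmerGroup_relaxed p S₀ κ J u hu hx hv hpv,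
    fun v hpv ↦ ?_, fun w ↦ ?_⟩
  · have hv : v ∉ S₀ := fun h ↦ hS₀ v h hpv
    exact W.twistedTorsionToLocalH1_eq_of_sub_mem_inr p S₀ κ J u hu hv hpv
      (hxt (Sum.inr v) ((inr_mem_twistedDescentPlaces_iff p S₀ v).2 (Or.inr hpv)))
  · exact W.twistedTorsionToLocalH1_eq_of_sub_mem_inl p S₀ κ J u hu w
      (hxt (Sum.inl w) (inl_mem_twistedDescentPlaces p S₀ w))

/-- **Two-term form.** When the target family is supported at `p` and `∞` (`t_v = 0` at the finite places
prime to `p`), orthogonality to `H¹_{𝓕^*}` is the vanishing of the local terms at the places above `p` and at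
the infinite places separately — the shape in which the twisted descent of the cell `bsd-2adic` proves it
(strict dual condition at `S₀`, Kummer self-duality at `∞`, Greenberg's `L_v`-duality at `p`).
[cite: GreenbergLNM1716, §4 pp. 122–124] [cite: Howard2004HeegnerKolyvagin, Thm. 2.1.11 (arXiv:1202.6340 p. 6)] -/
theorem exists_twistedLift_of_orthogonal_two {inv : LocalInvariants K (p ^ J)} (hSC : inv.SelmerComplement)
    (hS₀ : ∀ v ∈ S₀, ((p : ℕ) : 𝓞 K) ∉ v.asIdeal)
    (hS : ∀ v : HeightOneSpectrum (𝓞 K), (Sum.inr v : Place K) ∉ twistedDescentPlaces (K := K) p S₀ →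
      ((p ^ J : ℕ) : 𝓞 K) ∉ v.asIdeal ∧ GaloisRep.IsUnramifiedAt v (W.twistedTorsionGaloisModule p κ J u hu))
    (t : Π v : Place K, galoisCohomology ((W.twistedTorsionGaloisModule p κ J u hu).toLocal v) 1)
    (ht : ∀ v : HeightOneSpectrum (𝓞 K), ((p : ℕ) : 𝓞 K) ∉ v.asIdeal → t (Sum.inr v) = 0)
    (horth : ∀ y ∈ (inv.dualSelmerStructure (W.twistedTorsionGaloisModule p κ J u hu)
        (W.twistedKummerSelmerStructure p S₀ κ J u hu)).selmerGroup,
      (∀ v : HeightOneSpectrum (𝓞 K), ((p : ℕ) : 𝓞 K) ∈ v.asIdeal →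
        localTatePairingZMod (W.twistedTorsionGaloisModule p κ J u hu) (p ^ J) (Sum.inr v)
          (inv (Sum.inr v)) (t (Sum.inr v))
          (galoisCohomology.localization ((W.twistedTorsionGaloisModule p κ J u hu).tateDual (p ^ J))
            (Sum.inr v) 1 y) = 0) ∧
      (∀ w : InfinitePlace K,
        localTatePairingZMod (W.twistedTorsionGaloisModule p κ J u hu) (p ^ J) (Sum.inl w)
          (inv (Sum.inl w)) (t (Sum.inl w))
          (galoisCohomology.localization ((W.twistedTorsionGaloisModule p κ J u hu).tateDual (p ^ J))
            (Sum.inl w) 1 y) = 0)) :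
    ∃ x : galoisCohomology (W.twistedTorsionGaloisModule p κ J u hu) 1,
      (∀ v : HeightOneSpectrum (𝓞 K), v ∉ S₀ → ((p : ℕ) : 𝓞 K) ∉ v.asIdeal →
        galoisCohomology.res (W.twistedTorsionGaloisModule p κ J u hu) (v.adicCompletion K) 1 x ∈
          unramifiedSubgroup
            ((W.twistedTorsionGaloisModule p κ J u hu).restrictField (v.adicCompletion K)) 1) ∧
      (∀ v : HeightOneSpectrum (𝓞 K), ((p : ℕ) : 𝓞 K) ∈ v.asIdeal →
        W.twistedTorsionToLocalH1 p κ J u hu (v.adicCompletion K)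
            (galoisCohomology.res (W.twistedTorsionGaloisModule p κ J u hu) (v.adicCompletion K) 1 x) =
          W.twistedTorsionToLocalH1 p κ J u hu (v.adicCompletion K) (t (Sum.inr v))) ∧
      (∀ w : InfinitePlace K,
        W.twistedTorsionToLocalH1 p κ J u hu w.Completion
            (galoisCohomology.res (W.twistedTorsionGaloisModule p κ J u hu) w.Completion 1 x) =
          W.twistedTorsionToLocalH1 p κ J u hu w.Completion (t (Sum.inl w))) := by
  refine W.exists_twistedLift_of_orthogonal p S₀ κ J u hu hSC hS₀ hS t fun y hy ↦
    Finset.sum_eq_zero fun v _ ↦ ?_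
  rcases v with w | v
  · exact (horth y hy).2 w
  · by_cases hpv : ((p : ℕ) : 𝓞 K) ∈ v.asIdeal
    · exact (horth y hy).1 v hpv
    · rw [ht v hpv, map_zero, AddMonoidHom.zero_apply]

end WeierstrassCurve

end
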